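import Summits.ResolutionOfSingularities.ResolutionOfSingularities.Theorems.PurelyInseparableDim4JointWaitingNodeDefs
import HarnessLib

/-!
# Purely inseparable four-folds: NAMES for the node data of the joint forest with waiting members, II — the own-node block and the
# full coordinate-member datum (brick S3 (c) «joint point∘coordinate chains», part 49b = v3 threading, definitions; cell `res-dim4-pi`)

[OURS · counted 0] (D-0157 DOOR 2; desk WORD #66 (4)(c), #74 (g), #99 (d); frame `PIDim4.TerminationImpliesOrderReduction`, S3 (c) v3;
host item stmt-ResolutionOfSingularities-16155, helper). Nothing here proves resolution of singularities in dimension ≥ 4 / characteristic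
`p` — NOT here, not anywhere in this programme. NO theorem content: two more ABBREVIATING DEFINITIONS on top of part 49 (predicates with
explicit parameters, no axioms, no cited fact), so that the threading node theorem's STEP and INDUCTION fit the 400-line limit:

* `OwnBlock p plan leaves Wt q` — the conditions AT a member's own pair `q = (s, S)` when it hosts the waiting entries `Wt`: admissible and
  separated plan entries (P1, P2), leaf point walks (P3), and the THREE-WAY normalised cover (child / waiting entry / leaf) of part 37d;
* `MemberData p plan leaves M′ c s S Wt wr` — EVERYTHING part 20's node theorem asks of a coordinate member, plus the waiting data: basics
  (`s.F ≠ 0` clean, `S` permissible, `c` regular, snc with the boundary), `MemberChart` (part 49), `OwnBlock`, the v2 block `V2Block` at every pair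
  reachable from a CHILD pair or a WAITING-KID pair, `Acc` at the own pair, and for each waiting entry: kid-form admissibility (part 37d's
  `hW1`), `Acc` at its kid pair, its region missed by every boundary component; same-chart separations `hW2`, `hPW`.
* `ownBlock_of_v2Block` — with no waiting entries the two-way block implies the own-node block.

AI-produced formalisation, weaker than expert review. bears_on: LADDER-RESOLUTION:D157-DOOR2 (res-dim4-pi · S3 (c) joint v3 · threading defs).
-/

set_option linter.dupNamespace false -- D-0017: single-problem summit path `Summit.<S>.<S>.…` by design

noncomputable section

open MvPolynomial Finset CategoryTheory AlgebraicGeometry Opposite TopologicalSpace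
open AlgebraicGeometry.Scheme.IdealSheafData (ofIdealTop vanishingIdeal)

namespace Summit.ResolutionOfSingularities.ResolutionOfSingularities.Theorems.PIDim4

open Literature.AlgebraicGeometry.Resolution
open Literature.AlgebraicGeometry.Resolution.Hauser2010
open Literature.AlgebraicGeometry.Resolution.AffinePointBlowup (P A γ coord Wtop ξ)

namespace Equimultiple

section DefsTwo

variable {K : Type} [Field K] (p : ℕ) [DecidableEq K]

/-- **The own-node block of a member hosting waiting entries `Wt`** at its pair `q = (s, S)`: (P1) admissible plan entries, (P2) separated
plan entries, (P3) leaf point walks, and the THREE-WAY normalised cover «every normalised equimultiple pair agrees with a plan entry of its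
chart on `S″`, or with a waiting entry of its chart on `T`, or is a leaf» (part 37d). [cite: BierstoneGrigorievMilmanWlodarczyk2011, Def. 3.1.3; §4 Step 2b] -/
def OwnBlock (plan : State K → Finset (Fin 4) → Finset (Fin 4 × (Fin 4 → K) × Finset (Fin 4)))
    (leaves : State K → Finset (Fin 4) → Finset (Fin 4 × (Fin 4 → K))) (Wt : Finset (Fin 4 × (Fin 4 → K) × Finset (Fin 4)))
    (q : State K × Finset (Fin 4)) : Prop :=
  (∀ e ∈ plan q.1 q.2, e.1 ∈ q.2 ∧ e.2.1 e.1 = 0 ∧ q.2 ⊆ e.2.2 ∧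
      CentreBlowup.IsEquimultiplePoint p q.2 e.1 e.2.1 q.1 ∧
      IsPermissibleCentre p e.2.2 (CentreBlowup.step p q.2 e.1 e.2.1 q.1).F) ∧
  (∀ e ∈ plan q.1 q.2, ∀ e' ∈ plan q.1 q.2, e ≠ e' →
      (e.1 = e'.1 ∧ ∃ i ∈ e.2.2, i ∈ e'.2.2 ∧ e.2.1 i ≠ e'.2.1 i) ∨
      (e.1 ≠ e'.1 ∧ ((e'.2.1 e.1 = 0 ∧ e.1 ∈ e'.2.2) ∨ (e.2.1 e'.1 = 0 ∧ e'.1 ∈ e.2.2)))) ∧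
  (∀ l ∈ leaves q.1 q.2, CentreBlowup.IsEquimultiplePoint p q.2 l.1 l.2 q.1 →
      Acc (fun s' s : State K => Edge p Finset.univ s s') (CentreBlowup.step p q.2 l.1 l.2 q.1) ∧
      ∀ s' : State K, Relation.ReflTransGen (fun a e : State K => Edge p Finset.univ a e)
          (CentreBlowup.step p q.2 l.1 l.2 q.1) s' →
        {jb : Fin 4 × (Fin 4 → K) | jb.2 jb.1 = 0 ∧ CentreBlowup.IsEquimultiplePoint p Finset.univ jb.1 jb.2 s'}.Finite) ∧
  (∀ (j' : Fin 4) (b' : Fin 4 → K), j' ∈ q.2 → b' j' = 0 → (∀ k ∈ q.2, k < j' → b' k = 0) →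
      CentreBlowup.IsEquimultiplePoint p q.2 j' b' q.1 →
      (∃ e ∈ plan q.1 q.2, e.1 = j' ∧ ∀ i ∈ e.2.2, b' i = e.2.1 i) ∨ (∃ wt ∈ Wt, wt.1 = j' ∧ ∀ i ∈ wt.2.2, b' i = wt.2.1 i) ∨
        (j', b') ∈ leaves q.1 q.2)

/-- **With no waiting entries the two-way block gives the own-node block.** [folklore] -/
theorem ownBlock_of_v2Block (plan : State K → Finset (Fin 4) → Finset (Fin 4 × (Fin 4 → K) × Finset (Fin 4)))
    (leaves : State K → Finset (Fin 4) → Finset (Fin 4 × (Fin 4 → K))) (q : State K × Finset (Fin 4))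
    (h : V2Block p plan leaves q) : OwnBlock p plan leaves ∅ q := by
  obtain ⟨h1, h2, h3, h5⟩ := h
  refine ⟨h1, h2, h3, fun j' b' hj' hb' hnorm heq => ?_⟩
  rcases h5 j' b' hj' hb' hnorm heq with h | h
  · exact Or.inl h
  · exact Or.inr (Or.inr h)

variable {X' : Scheme.{0}}

/-- **The full datum of a COORDINATE MEMBER `c` of a node with waiting entries** (state `s`, centre `S`, waiting entries `Wt`, regions `wr`):
basics · `MemberChart` · `OwnBlock` at `(s, S)` · `V2Block` at every pair reachable from a child pair or a waiting-kid pair · `Acc` of the flipped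
child relation at `(s, S)` · per waiting entry `(j, c, T)`: `j ∈ S`, `c|_S = 0`, `S ∖ {j} ⊆ T`, `j ∉ T`, `T` permissible for the kid state, `Acc` at
the kid pair, the region missed by every boundary component · same-chart separations among waiting entries and against plan entries.
[cite: BierstoneGrigorievMilmanWlodarczyk2011, Def. 3.1.3] [cite: Hauser2010, §§F–G] -/
def MemberData [IsAlgClosed K] [CharP K p] [Fact p.Prime]
    (plan : State K → Finset (Fin 4) → Finset (Fin 4 × (Fin 4 → K) × Finset (Fin 4)))
    (leaves : State K → Finset (Fin 4) → Finset (Fin 4 × (Fin 4 → K))) (M' : MarkedIdeal X') (c : Closeds X') (s : State K)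
    (S : Finset (Fin 4)) (Wt : Finset (Fin 4 × (Fin 4 → K) × Finset (Fin 4))) (wr : Fin 4 × (Fin 4 → K) × Finset (Fin 4) → Closeds X') :
    Prop :=
  s.F ≠ 0 ∧ Literature.Barriers.ResolutionOfSingularities.HauserPerlega.IsClean p s.F ∧ IsPermissibleCentre p S s.F ∧
  Scheme.IsRegular (vanishingIdeal c).subscheme ∧ HasSNCWith M'.boundary (vanishingIdeal c) ∧
  MemberChart p M' c s S Wt wr ∧
  OwnBlock p plan leaves Wt (s, S) ∧
  (∀ q : State K × Finset (Fin 4),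
    ((∃ e ∈ plan s S, Relation.ReflTransGen (fun q q' : State K × Finset (Fin 4) =>
        ∃ e ∈ plan q.1 q.2, q' = (CentreBlowup.step p q.2 e.1 e.2.1 q.1, e.2.2)) (CentreBlowup.step p S e.1 e.2.1 s, e.2.2) q) ∨
      ∃ wt ∈ Wt, Relation.ReflTransGen (fun q q' : State K × Finset (Fin 4) =>
        ∃ e ∈ plan q.1 q.2, q' = (CentreBlowup.step p q.2 e.1 e.2.1 q.1, e.2.2)) (CentreBlowup.step p S wt.1 wt.2.1 s, wt.2.2) q) →
    V2Block p plan leaves q) ∧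
  Acc (fun q' q : State K × Finset (Fin 4) => ∃ e ∈ plan q.1 q.2, q' = (CentreBlowup.step p q.2 e.1 e.2.1 q.1, e.2.2)) (s, S) ∧
  (∀ wt ∈ Wt, wt.1 ∈ S ∧ (∀ i ∈ S, wt.2.1 i = 0) ∧ S.erase wt.1 ⊆ wt.2.2 ∧ wt.1 ∉ wt.2.2 ∧
    IsPermissibleCentre p wt.2.2 (CentreBlowup.step p S wt.1 wt.2.1 s).F ∧
    Acc (fun q' q : State K × Finset (Fin 4) => ∃ e ∈ plan q.1 q.2, q' = (CentreBlowup.step p q.2 e.1 e.2.1 q.1, e.2.2))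
      (CentreBlowup.step p S wt.1 wt.2.1 s, wt.2.2) ∧
    ∀ D ∈ M'.boundary, Disjoint (D.support : Set X') (wr wt : Set X')) ∧
  (∀ wt ∈ Wt, ∀ wt' ∈ Wt, wt ≠ wt' → wt.1 = wt'.1 → ∃ i ∈ wt.2.2, i ∈ wt'.2.2 ∧ wt.2.1 i ≠ wt'.2.1 i) ∧
  (∀ e ∈ plan s S, ∀ wt ∈ Wt, e.1 = wt.1 → ∃ i ∈ e.2.2, i ∈ wt.2.2 ∧ e.2.1 i ≠ wt.2.1 i)

end DefsTwo

end Equimultiple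

end Summit.ResolutionOfSingularities.ResolutionOfSingularities.Theorems.PIDim4

end
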